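import Literature.LinearAlgebra.Matrix.FiniteFieldHermitianAnisotropic
import HarnessLib

/-!
# Hermitian forms over a finite field, II: every non-degenerate `σ`-hermitian form over `𝔽_{q²}` is congruent to `1`
# (Wilson, *The Finite Simple Groups*, §3.4.5 «Classification of sesquilinear forms» p. 57, §3.6 (3.25))

Topic `Literature/LinearAlgebra/Matrix`; namespace `Literature.LinearAlgebra.Matrix`. THEOREMS ONLY (no definition, no named fact, no instance, no
notation). Sequel of `FiniteFieldHermitianAnisotropic.lean`; set-up of ★ `HermitianSphereCount` (`Fintype.card k = q ^ 2`, `σ : k →+* k`, `σ x = x ^ q`).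

* §1 the Gram–Schmidt step on `k^{n+1}`: from a unit vector `v` (`h_J(v,v) = 1`, `v i₀ ≠ 0`) the explicit matrices `S₀ = [v | e_{i₀.succAbove ·}]`
  (`det S₀ = (−1)^{i₀} v i₀`, Laplace along column `0`) and the unipotent `U` (column `succ j ↦ e_{succ j} − c_j e_0`, `c_j = h_J(v, e_{i₀.succAbove j})`) give
  `S = S₀ U` with `S e_0 = v`, `h_J(v, S e_{succ j}) = 0`, `det S ≠ 0`; hence `σ(S)ᵀ J S = 1 ⊕ J'` with `J'` hermitian, `det J' ≠ 0`
  (`conj_step_shape`); and the block-diagonal re-assembly `σ(1 ⊕ T')ᵀ (1 ⊕ J') (1 ⊕ T') = 1` (`conj_blockDiag_eq_one`);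
* §2 **`exists_formCongr_eq_one`**: for every `σ`-hermitian `J : Matrix (Fin n) (Fin n) k` with `det J ≠ 0` there is `T : GL (Fin n) k` with
  `formCongr σ T J = σ(T)ᵀ J T = 1` (induction on `n`; `n = 0` trivial, the step = §1 + ★ `exists_hermPair_self_eq_one`); **`exists_formCongr_one_eq`**
  (`∃ T, formCongr σ T 1 = J`, via ★ `formCongr_inv_formCongr`); **`card_unitaryGroupOfForm_of_hermitian`**:
  `(Nat.card (unitaryGroupOfForm σ J) : ℤ) = q^{n(n−1)∕2} ∏_{i<n} (q^{i+1} − (−1)^{i+1})` for EVERY non-degenerate hermitian `J`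
  (★ `card_unitaryGroupOfForm_formCongr_one`) — the form F0P3's «D-T1u» consumes at `k = 𝓀[E_w]`, `J = J̄`.

## References
* R. A. Wilson, *The Finite Simple Groups*, GTM 251 (2009), §3.6 p. 66, (3.25) [Wilson2009].
-/

set_option autoImplicit false

noncomputable section

open Finset Matrix Literature.FieldTheory.FiniteFields Literature.NumberTheory.Automorphic Literature.GroupTheory.SpecificGroups

namespace Literature.LinearAlgebra.Matrix

variable {k : Type*} [Field k] [Fintype k] {q : ℕ} {n : ℕ}

/-! ### §1 The Gram–Schmidt step -/

omit [Fintype k] in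
/-- `det [v | e_{i₀.succAbove 0} | … ] = (−1)^{i₀} · v i₀`: Laplace expansion along column `0`; the minor at row `i₀` is the identity, every other minor has a
zero row. [cite: Wilson2009, §3.4.5 p. 57] -/
theorem det_consColumn_single (v : Fin (n + 1) → k) (i₀ : Fin (n + 1)) :
    (Matrix.of fun i : Fin (n + 1) => (Fin.cons (v i) (fun j' : Fin n => if i = i₀.succAbove j' then (1 : k) else 0) : Fin (n + 1) → k)).det =
      (-1) ^ (i₀ : ℕ) * v i₀ := by
  rw [det_succ_column_zero, sum_eq_single i₀]
  · have hsub : (Matrix.of fun i : Fin (n + 1) => (Fin.cons (v i) (fun j' : Fin n => if i = i₀.succAbove j' then (1 : k) else 0) :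
        Fin (n + 1) → k)).submatrix i₀.succAbove Fin.succ = 1 := by
      ext a b
      simp only [submatrix_apply, of_apply, Fin.cons_succ, Fin.succAbove_right_inj, one_apply]
    rw [hsub, det_one, mul_one, of_apply, Fin.cons_zero]
  · intro i _ hi
    obtain ⟨a, ha⟩ := Fin.exists_succAbove_eq (Ne.symm hi)
    rw [det_eq_zero_of_row_eq_zero a fun j => ?_, mul_zero]
    simp only [submatrix_apply, of_apply, Fin.cons_succ, ha]
    rw [if_neg (Fin.succAbove_ne i₀ j).symm]
  · intro h; exact absurd (mem_univ i₀) h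

omit [Fintype k] in
/-- The unipotent matrix `U` (`U 0 0 = 1`, `U 0 (succ j) = −c j`, `U (succ i) 0 = 0`, `U (succ i) (succ j) = δ_{ij}`) has determinant `1`. [cite: Wilson2009, §3.4.5 p. 57] -/
theorem det_unipotent_cons (c : Fin n → k) :
    (Matrix.of (Fin.cons (Fin.cons (1 : k) (fun j' => -c j') : Fin (n + 1) → k)
      (fun i' : Fin n => (Fin.cons (0 : k) (fun j' : Fin n => if i' = j' then (1 : k) else 0) : Fin (n + 1) → k))) :
        Matrix (Fin (n + 1)) (Fin (n + 1)) k).det = 1 := by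
  rw [det_of_upperTriangular]
  · rw [Fin.prod_univ_succ]
    simp [of_apply, Fin.cons_zero, Fin.cons_succ]
  · intro i j hij
    simp only [id] at hij
    induction i using Fin.cases with
    | zero => exact absurd hij (Fin.not_lt_zero _)
    | succ i' =>
      induction j using Fin.cases with
      | zero => simp only [of_apply, Fin.cons_succ, Fin.cons_zero]
      | succ j' =>
        simp only [of_apply, Fin.cons_succ]
        rw [if_neg]
        exact fun h => (lt_irrefl _) (h ▸ (Fin.succ_lt_succ_iff.1 hij))

/-- **The Gram–Schmidt step.** For `σ`-hermitian `J` on `k^{n+1}` with `det J ≠ 0` and a unit vector `v` (`h_J(v,v) = 1`) there is a matrix `S` with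
`det S ≠ 0` such that `J₂ := σ(S)ᵀ J S` satisfies `J₂ 0 0 = 1`, `J₂ 0 (succ j) = 0`, `J₂ (succ j) 0 = 0` (so `J₂ = 1 ⊕ J'`), with `J₂` hermitian and
`det J₂ ≠ 0`. (`S = S₀ U`: `S e_0 = v`, `S e_{succ j} = e_{i₀.succAbove j} − h_J(v, e_{i₀.succAbove j}) • v` where `v i₀ ≠ 0`.) [cite: Wilson2009, §3.4.5 p. 57, (3.21)] -/
theorem conj_step_shape (hk : Fintype.card k = q ^ 2) (σ : k →+* k) (hσ : ∀ x, σ x = x ^ q)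
    {J : Matrix (Fin (n + 1)) (Fin (n + 1)) k} (hJ : (J.map σ)ᵀ = J) (hdet : J.det ≠ 0)
    {v : Fin (n + 1) → k} (hv : (σ ∘ v) ⬝ᵥ (J *ᵥ v) = 1) :
    ∃ S : Matrix (Fin (n + 1)) (Fin (n + 1)) k, S.det ≠ 0 ∧
      ((S.map σ)ᵀ * J * S) 0 0 = 1 ∧ (∀ j : Fin n, ((S.map σ)ᵀ * J * S) 0 j.succ = 0) ∧ (∀ j : Fin n, ((S.map σ)ᵀ * J * S) j.succ 0 = 0) ∧
      ((((S.map σ)ᵀ * J * S).map σ)ᵀ = (S.map σ)ᵀ * J * S) ∧ ((S.map σ)ᵀ * J * S).det ≠ 0 := by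
  classical
  -- a coordinate where `v` is non-zero
  have hv0 : v ≠ 0 := by
    rintro rfl
    have : (σ ∘ (0 : Fin (n + 1) → k)) ⬝ᵥ (J *ᵥ 0) = 0 := by simp [dotProduct]
    rw [this] at hv; exact zero_ne_one hv
  obtain ⟨i₀, hi₀⟩ := Function.ne_iff.1 hv0
  -- the coefficients `c_j = h_J(v, e_{i₀.succAbove j})`
  set c : Fin n → k := fun j' => (σ ∘ v) ⬝ᵥ (J *ᵥ Pi.single (i₀.succAbove j') 1) with hc
  set S₀ : Matrix (Fin (n + 1)) (Fin (n + 1)) k :=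
    Matrix.of fun i : Fin (n + 1) => (Fin.cons (v i) (fun j' : Fin n => if i = i₀.succAbove j' then (1 : k) else 0) : Fin (n + 1) → k) with hS₀
  set U : Matrix (Fin (n + 1)) (Fin (n + 1)) k :=
    Matrix.of (Fin.cons (Fin.cons (1 : k) (fun j' => -c j') : Fin (n + 1) → k)
      (fun i' : Fin n => (Fin.cons (0 : k) (fun j' : Fin n => if i' = j' then (1 : k) else 0) : Fin (n + 1) → k))) with hU
  refine ⟨S₀ * U, ?_, ?_⟩
  · rw [det_mul, hS₀, det_consColumn_single, hU, det_unipotent_cons, mul_one]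
    exact mul_ne_zero (pow_ne_zero _ (neg_ne_zero.2 one_ne_zero)) hi₀
  -- the columns of `S = S₀ U`
  have hcol0 : (fun i => (S₀ * U) i 0) = v := by
    funext i
    rw [mul_apply, Fin.sum_univ_succ]
    simp [hS₀, hU]
  have hcolS : ∀ j' : Fin n, (fun i => (S₀ * U) i j'.succ) = (-c j') • v + Pi.single (i₀.succAbove j') 1 := by
    intro j'
    funext i
    rw [mul_apply, Fin.sum_univ_succ]
    simp only [hS₀, hU, of_apply, Fin.cons_zero, Fin.cons_succ, mul_ite, mul_one, mul_zero, Pi.add_apply, Pi.smul_apply, smul_eq_mul,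
      Pi.single_apply]
    rw [sum_ite_eq' univ j', if_pos (mem_univ _)]
    ring
  have h00 : (((S₀ * U).map σ)ᵀ * J * (S₀ * U)) 0 0 = 1 := by
    rw [transpose_map_mul_mul_apply, hcol0, hv]
  have h0s : ∀ j : Fin n, (((S₀ * U).map σ)ᵀ * J * (S₀ * U)) 0 j.succ = 0 := by
    intro j'
    rw [transpose_map_mul_mul_apply, hcol0, hcolS, hermPair_add_right, hermPair_smul_right, hv,
      show (σ ∘ v) ⬝ᵥ (J *ᵥ Pi.single (i₀.succAbove j') 1) = c j' from rfl]
    ring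
  have hherm := transpose_map_conj_of_hermitian hk σ hσ hJ (S₀ * U)
  have hs0 : ∀ j : Fin n, (((S₀ * U).map σ)ᵀ * J * (S₀ * U)) j.succ 0 = 0 := by
    intro j'
    have h := congrFun (congrFun hherm j'.succ) 0
    rw [transpose_apply, map_apply, h0s, map_zero] at h
    exact h.symm
  refine ⟨h00, h0s, hs0, hherm, ?_⟩
  rw [det_mul, det_mul, det_transpose, ← RingHom.mapMatrix_apply, ← RingHom.map_det]
  refine mul_ne_zero (mul_ne_zero ?_ hdet) ?_
  · rw [map_ne_zero]; rw [det_mul, hS₀, det_consColumn_single, hU, det_unipotent_cons, mul_one]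
    exact mul_ne_zero (pow_ne_zero _ (neg_ne_zero.2 one_ne_zero)) hi₀
  · rw [det_mul, hS₀, det_consColumn_single, hU, det_unipotent_cons, mul_one]
    exact mul_ne_zero (pow_ne_zero _ (neg_ne_zero.2 one_ne_zero)) hi₀

omit [Fintype k] in
/-- **Block-diagonal re-assembly**: if `J₂ = 1 ⊕ J'` (`J₂ 0 0 = 1`, off-diagonal blocks zero) and `σ(T')ᵀ J' T' = 1` for the lower block
`J' a b = J₂ (succ a) (succ b)`, then `D = 1 ⊕ T'` satisfies `σ(D)ᵀ J₂ D = 1`. [cite: Wilson2009, §3.4.5 p. 57, (3.21)] -/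
theorem conj_blockDiag_eq_one (σ : k →+* k) {J₂ : Matrix (Fin (n + 1)) (Fin (n + 1)) k}
    (h00 : J₂ 0 0 = 1) (h0s : ∀ j : Fin n, J₂ 0 j.succ = 0) (hs0 : ∀ j : Fin n, J₂ j.succ 0 = 0)
    {T' : Matrix (Fin n) (Fin n) k} (hT' : (T'.map σ)ᵀ * (Matrix.of fun a b : Fin n => J₂ a.succ b.succ) * T' = 1) :
    ((Matrix.of (Fin.cons (Fin.cons (1 : k) (fun _ : Fin n => (0 : k)) : Fin (n + 1) → k)
        (fun i' : Fin n => (Fin.cons (0 : k) (fun j' : Fin n => T' i' j') : Fin (n + 1) → k))) : Matrix (Fin (n + 1)) (Fin (n + 1)) k).map σ)ᵀ *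
      J₂ * (Matrix.of (Fin.cons (Fin.cons (1 : k) (fun _ : Fin n => (0 : k)) : Fin (n + 1) → k)
        (fun i' : Fin n => (Fin.cons (0 : k) (fun j' : Fin n => T' i' j') : Fin (n + 1) → k)))) = 1 := by
  have hT : ∀ a b : Fin n, ∑ i, ∑ l, σ (T' i a) * J₂ i.succ l.succ * T' l b = if a = b then 1 else 0 := by
    intro a b
    have h := congrFun (congrFun hT' a) b
    rw [transpose_map_mul_mul_apply, hermPair_eq_sum, one_apply] at h
    simpa only [of_apply] using h
  ext a b
  rw [transpose_map_mul_mul_apply, hermPair_eq_sum, one_apply]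
  simp only [Fin.sum_univ_succ, of_apply, Fin.cons_zero, Fin.cons_succ, h00, h0s, hs0, zero_mul, mul_zero, mul_one,
    sum_const_zero, zero_add, add_zero]
  induction a using Fin.cases with
  | zero =>
    induction b using Fin.cases with
    | zero => simp
    | succ b' => simp [(Fin.succ_ne_zero b').symm]
  | succ a' =>
    induction b using Fin.cases with
    | zero => simp [Fin.succ_ne_zero]
    | succ b' => simp only [Fin.cons_succ, Fin.succ_inj, map_zero, zero_mul, zero_add]; exact hT a' b'

/-! ### §2 Congruence to the standard form, and the order of `U(σ, J)` -/

/-- **Every non-degenerate `σ`-hermitian form over `𝔽_{q²}` is congruent to the standard form**: for `(J.map σ)ᵀ = J` with `det J ≠ 0` there is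
`T ∈ GL_n(k)` with `σ(T)ᵀ J T = 1` (an orthonormal basis; hermitian forms over finite fields are classified by rank). Induction on `n` by the Gram–Schmidt
step; `n = 0` is trivial and `n = 1` is ★ `exists_formCongr_eq_one_fin_one`. [cite: Wilson2009, §3.4.5 p. 57, (3.21)] [cite: Wilson2009, §3.6 p. 66] -/
theorem exists_formCongr_eq_one (hk : Fintype.card k = q ^ 2) (σ : k →+* k) (hσ : ∀ x, σ x = x ^ q) :
    ∀ (n : ℕ) (J : Matrix (Fin n) (Fin n) k), (J.map σ)ᵀ = J → J.det ≠ 0 → ∃ T : GL (Fin n) k, formCongr σ T J = 1 := by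
  intro n
  induction n with
  | zero => intro J _ _; exact ⟨1, Subsingleton.elim _ _⟩
  | succ n ih =>
    intro J hJ hdet
    classical
    obtain ⟨v, hv⟩ := exists_hermPair_self_eq_one hk σ hσ hJ hdet
    obtain ⟨S, hSdet, h00, h0s, hs0, hherm, hdet₂⟩ := conj_step_shape hk σ hσ hJ hdet hv
    set J₂ := (S.map σ)ᵀ * J * S with hJ₂
    -- the lower block `J'`
    have hJ' : ((Matrix.of fun a b : Fin n => J₂ a.succ b.succ).map σ)ᵀ = Matrix.of fun a b : Fin n => J₂ a.succ b.succ := by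
      ext a b
      have h := congrFun (congrFun hherm a.succ) b.succ
      rw [transpose_apply, map_apply] at h
      rw [transpose_apply, map_apply, of_apply, of_apply]
      exact h
    have hdet' : (Matrix.of fun a b : Fin n => J₂ a.succ b.succ).det ≠ 0 := by
      have h : J₂.det = (Matrix.of fun a b : Fin n => J₂ a.succ b.succ).det := by
        rw [det_succ_column_zero, Fin.sum_univ_succ, sum_eq_zero fun i _ => by rw [hs0, mul_zero, zero_mul]]
        simp only [Fin.val_zero, pow_zero, h00, one_mul, add_zero, Fin.succAbove_zero]
        rfl
      rwa [← h]
    obtain ⟨T', hT'⟩ := ih _ hJ' hdet'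
    have hT'm : ((T' : Matrix (Fin n) (Fin n) k).map σ)ᵀ * (Matrix.of fun a b : Fin n => J₂ a.succ b.succ) * (T' : Matrix (Fin n) (Fin n) k) = 1 := hT'
    have hD := conj_blockDiag_eq_one σ h00 h0s hs0 hT'm
    set D : Matrix (Fin (n + 1)) (Fin (n + 1)) k := Matrix.of (Fin.cons (Fin.cons (1 : k) (fun _ : Fin n => (0 : k)) : Fin (n + 1) → k)
        (fun i' : Fin n => (Fin.cons (0 : k) (fun j' : Fin n => (T' : Matrix (Fin n) (Fin n) k) i' j') : Fin (n + 1) → k))) with hDdef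
    -- `T = S D`
    have hT : ((S * D).map σ)ᵀ * J * (S * D) = 1 := by
      rw [Matrix.map_mul, transpose_mul, Matrix.mul_assoc, Matrix.mul_assoc, ← Matrix.mul_assoc J, ← Matrix.mul_assoc ((S.map σ)ᵀ),
        ← Matrix.mul_assoc ((S.map σ)ᵀ), ← hJ₂, ← Matrix.mul_assoc]
      exact hD
    have hTdet : (S * D).det ≠ 0 := by
      intro h0
      have h := congrArg Matrix.det hT
      rw [det_mul, h0, mul_zero, det_one] at h
      exact zero_ne_one h
    exact ⟨GeneralLinearGroup.mkOfDetNeZero _ hTdet, hT⟩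

/-- The same, solved for `J`: `∃ T ∈ GL_n(k)`, `σ(T)ᵀ · 1 · T = J`. [cite: Wilson2009, §3.4.5 p. 57, (3.21)] -/
theorem exists_formCongr_one_eq (hk : Fintype.card k = q ^ 2) (σ : k →+* k) (hσ : ∀ x, σ x = x ^ q)
    (J : Matrix (Fin n) (Fin n) k) (hJ : (J.map σ)ᵀ = J) (hdet : J.det ≠ 0) :
    ∃ T : GL (Fin n) k, formCongr σ T 1 = J := by
  obtain ⟨T, hT⟩ := exists_formCongr_eq_one hk σ hσ n J hJ hdet
  refine ⟨T⁻¹, ?_⟩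
  rw [← hT, formCongr_inv_formCongr]

/-- **The order of the unitary group of ANY non-degenerate hermitian form over `𝔽_{q²}`**: for `(J.map σ)ᵀ = J`, `det J ≠ 0`,
`|U(σ, J)| = q^{n(n−1)∕2} ∏_{i=1}^{n} (q^i − (−1)^i)` (★ `card_unitaryGroupOfForm_formCongr_one` along the congruence `J = σ(T)ᵀ T`).
[cite: Wilson2009, §3.6 p. 66, (3.25)] [cite: Wilson2009, §3.4.5 p. 57, (3.21)] -/
theorem card_unitaryGroupOfForm_of_hermitian (hk : Fintype.card k = q ^ 2) (σ : k →+* k) (hσ : ∀ x, σ x = x ^ q)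
    (J : Matrix (Fin n) (Fin n) k) (hJ : (J.map σ)ᵀ = J) (hdet : J.det ≠ 0) :
    (Nat.card (unitaryGroupOfForm σ J) : ℤ) = (q : ℤ) ^ (n * (n - 1) / 2) * ∏ i ∈ range n, ((q : ℤ) ^ (i + 1) - (-1) ^ (i + 1)) := by
  classical
  obtain ⟨T, hT⟩ := exists_formCongr_one_eq hk σ hσ J hJ hdet
  rw [← hT]
  exact card_unitaryGroupOfForm_formCongr_one hk σ hσ T

/-- `ℕ` form of the previous count (factors `q^i − 1` ∕ `q^i + 1` by parity). [cite: Wilson2009, §3.6 p. 66, (3.25)] -/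
theorem card_unitaryGroupOfForm_of_hermitian_nat (hk : Fintype.card k = q ^ 2) (σ : k →+* k) (hσ : ∀ x, σ x = x ^ q)
    (J : Matrix (Fin n) (Fin n) k) (hJ : (J.map σ)ᵀ = J) (hdet : J.det ≠ 0) :
    Nat.card (unitaryGroupOfForm σ J) = q ^ (n * (n - 1) / 2) * ∏ i ∈ range n, (if Even (i + 1) then q ^ (i + 1) - 1 else q ^ (i + 1) + 1) := by
  classical
  obtain ⟨T, hT⟩ := exists_formCongr_one_eq hk σ hσ J hJ hdet
  rw [← hT, natCard_unitaryGroupOfForm_formCongr σ T, card_unitaryGroupOfForm_one_nat hk σ hσ]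

end Literature.LinearAlgebra.Matrix

end
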